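import Summits.BirchSwinnertonDyer.BirchSwinnertonDyer.Theorems.EisensteinPrimesMazurMCOnCellBOfNamedFactsV10
import Summits.BirchSwinnertonDyer.BirchSwinnertonDyer.Theorems.EisensteinPrimesMazurMCOnCellBTwistbackOrderOneAnchorZigzag
import HarnessLib

/-!
# Crux 3 `MazurMCOnCellB` (stmt-BirchSwinnertonDyer-19033), line `twistback` v11 (LEAD x2-p1 g15): the crux BY NAME is a TREE
# theorem conditional on EXACTLY the v11 cone — `PublishedInputs` + EIGHT PUBLISHED named facts + Keller–Yin Thm. D (PRE) +
# the open stub 6⁶ `stub_upperPartnerOffSubrowNoConnectedClassShaUnitNoOrderOneAnchor` («(∃-PARTNER) at X2b pairs off the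
# sub-row whose isogeny class is CONNECTED, by a zig-zag of certified two-step edges, to NO Ш-unit class and to NO non-split
# vertex carrying ONE order-one admissible twist»)

LEAD seat `bsd-line-x2-p1` g15 (2026-08-28; `--supports` stmt-BirchSwinnertonDyer-19033; successor of LEAD g14's p672690
`…OfNamedFactsV10` for the v11 stub). THEOREMS ONLY: no `def`, no named fact introduced, no `sorry`; every step is a by-name
application of a landed tree theorem: p671228 §1 (Ш-unit class, PUBLISHED only), x2-p1-w3 g14's zig-zag door p671590
`…TwistbackDefectSwapZigzag.mazurMainConjectureAt_of_cellB_of_connectedClassShaUnit`, THIS seat's road-(b) anchor door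
p675388 `…TwistbackOrderOneAnchorZigzag.mazurMainConjectureAt_of_cellB_of_connectedOrderOneAnchor` (x2-p1-w3 g11's
PUBLISHED-only order-one door p661229 §1 at the anchor, x2-p1-w6 g2's per-pair core p663790 = STEP L ⟸ Keller–Yin Thm. D +
Hsieh + LZZ with Poitou–Tate discharged, the zig-zag transport p671590, Cassels, exact converse), x2-p1-w3 g11's sub-row
theorem p661280, and p663790 on the last branch.

WHAT. `mazurMCOnCellB_of_namedFacts_of_upperPartnerOffSubrowNoConnectedClassShaUnitNoOrderOneAnchor` — CRUX 3 BY NAME from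
EXACTLY the v11 cone: `PublishedInputs` + {Disegni 2020 Thm. 4(1), Mazur Cor. 4.1, Hsieh 2014, LZZ 2018, Greenberg–Vatsal Thm.
(3.11), Disegni 2020 Thm. 2.4, Nakagawa–Horie–Taya, Wuthrich 2014 Prop. 21} + Keller–Yin Thm. D + 6⁶ (VERBATIM the v11 stub,
hypothesis `hStub`) — the v11 skeleton's per-pair composition on the Theorems side, FOUR branches: Ш-unit class ↦ p671228 §1
(PUB); CONNECTED to a Ш-unit class ↦ p671590; CONNECTED to a non-split ORDER-ONE ANCHOR ↦ p675388 §2; else the partner field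
comes from the sub-row theorem p661280 (PUBLISHED inputs) or from `hStub`, and p663790 concludes. The v10 twin's hypothesis is
implied by this one's (one negated hypothesis fewer), so this theorem is the stronger record; the named facts are the same 8+1+1.

HONEST FRAMING: conditional theorem; the named facts enter exactly as labelled (PUBLISHED ×8 + the route's FACT item -19037;
Keller–Yin Thm. D is an UNREFEREED PREPRINT, arXiv:2402.12781v2 Thm. 5.1.3, flag `KYD-gap`); stub 6⁶ is OPEN as registered —
its excluded population («W's class is connected to a Ш-unit class OR to a non-split order-one anchor») is EXPECTED to be every
X2b pair (idea-12 ANCHOR-CENSUS-g8 46/46 for Ш-units alone; road (b)'s supply = Schneider's conjecture at one partner) but is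
proved for NO infinite family; no registered stub is closed by this file; no summit statement, no Mazur main conjecture and no
BSD is proved for any curve unconditionally; 0 cells / labels / tiers move. BSD is not proved by any of this.

References: [KellerYin2024] Thm. D (PRE); [Wuthrich2014] Thm. 16, Prop. 21; [Disegni2020] Thm. 4, §2.2 Thm. 2.4;
[GreenbergVatsal2000] Thm. (1.3), §3 Thm. (3.11); [LiuZhangZhang2018] Thms. 1.5.1/1.5.3; [Hsieh2014] Thm. 1; [Mazur1978] Cor.
4.1; [NakagawaHorie1988] Thm. 1; [PerrinRiou1987] §1.4; [MilneADT2006] I Thm. 7.3; [Miller2011LMS] Def. 1.1.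
-/


set_option autoImplicit false
-- `Summit.BirchSwinnertonDyer.BirchSwinnertonDyer.…`: the summit and its single sub-problem share a name.
set_option linter.dupNamespace false

noncomputable section

open scoped Classical MatrixGroups ModularForm

open CongruenceSubgroup WeierstrassCurve NumberField IsDedekindDomain Field
  Literature.NumberTheory.GaloisRepresentations
  Literature.NumberTheory.EllipticCurves
  Literature.NumberTheory.EllipticCurves.ModularForms
  Literature.NumberTheory.QuadraticFields
  Literature.NumberTheory.EllipticCurves.Rank1Residual
  Literature.NumberTheory.EllipticCurves.Rank1Residual.Typed
  Literature.NumberTheory.EllipticCurves.Wuthrich2014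
  Literature.NumberTheory.EllipticCurves.SteinWuthrich2013
  Literature.NumberTheory.EllipticCurves.GreenbergVatsal2000
  Literature.NumberTheory.EllipticCurves.Disegni2020
  Summit.BirchSwinnertonDyer.Rank1Residual
  Summit.BirchSwinnertonDyer.BirchSwinnertonDyer.Theses
  Summit.BirchSwinnertonDyer.BirchSwinnertonDyer.Theorems
  Summit.BirchSwinnertonDyer.BirchSwinnertonDyer.Theorems.EisensteinPrimesMazurMCOnCellBTwistbackTwoStepDefs

namespace Summit.BirchSwinnertonDyer.BirchSwinnertonDyer.Theorems.EisensteinPrimesMazurMCOnCellBOfNamedFactsV11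

/-! ## Crux 3 BY NAME from EXACTLY the v11 cone -/

/-- **CRUX 3 `MazurMCOnCellB` BY NAME from `PublishedInputs` + EIGHT PUBLISHED named facts + Keller–Yin Thm. D (PRE) + the
registered v11 open stub 6⁶ `stub_upperPartnerOffSubrowNoConnectedClassShaUnitNoOrderOneAnchor` (statement VERBATIM as
`hStub`).** The v11 skeleton's per-pair composition on the Theorems side: at an X2b pair `(W, p)` — a Ш-unit class ↦ p671228 §1
(PUBLISHED only); a CONNECTED Ш-unit class ↦ x2-p1-w3 g14's zig-zag door p671590 (+ Thm. D); a CONNECTED non-split ORDER-ONE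
ANCHOR ↦ LEAD g15's door p675388 §2 (road (b) at the anchor by x2-p1-w3 g11's p661229 §1 — Perrin-Riou + Disegni Thm. 2.4 ⟹
`r_an = 1`, Disegni Thm. 4(1) under Greenberg–Vatsal ⟹ upper half —, STEP L at the anchor by p663790, zig-zag transport
p671590, Cassels, exact converse; + Thm. D); otherwise the partner field comes from the sub-row theorem (x2-p1-w3 g11 p661280,
PUBLISHED inputs: Disegni Thm. 4(1), Greenberg–Vatsal (3.11), Disegni Thm. 2.4, Nakagawa–Horie–Taya) or from `hStub`, a
globally minimal model of the twist exists (`exists_isGloballyMinimal_smul_eq_quadraticTwist`), and x2-p1-w6 g2's per-pair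
door p663790 `…OnePartnerAt.mazurMainConjectureAt_of_cellB_of_upper_partnerAt` concludes (STEP L = item -27489 ⟸ Thm. D +
Poitou–Tate + Hsieh + LZZ inside). Of the v8–v11 `stub_printedFacts` (8 conjuncts) ALL are consumed. CONDITIONAL on every
listed named fact and on the OPEN stub; nothing about any curve is proved unconditionally; BSD is not proved.
[claim: KellerYin2024, status: under-review] [cite: KellerYin2024, Thm. D = Thm. 5.1.3] [cite: Disegni2020, Thm. 4 (§3.2) and §2.2 Thm. 2.4]
[cite: GreenbergVatsal2000, §3 Thm. (3.11) (p. 43)] [cite: NakagawaHorie1988, Thm. 1] [cite: Wuthrich2014, Prop. 21 (p. 400)]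
[cite: PerrinRiou1987, §1.4 Cor. 1.8] [cite: LiuZhangZhang2018, Thms. 1.5.1 and 1.5.3] [cite: Hsieh2014, Thm. 1] [cite: Mazur1978, Cor. 4.1]
[cite: Miller2011LMS, Def. 1.1] -/
theorem mazurMCOnCellB_of_namedFacts_of_upperPartnerOffSubrowNoConnectedClassShaUnitNoOrderOneAnchor
    (hP : EisensteinPrimes.PublishedInputs) (hW21 : sha_dvd_analyticSha)
    (hDis : padicBSD_rankOne_nonsplitMult) (hMaz : mazur_not_dvd_maninConstant_of_odd)
    (hH : hsieh2014_exists_anticyclotomicPAdicLFunction) (hF : LiuZhangZhang2018.thm151_thm153_modularCurve_heegnerVector)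
    (h311 : thm311_hasUnitContent_iff_and_order_eq_of_lineRamifiedEven)
    (hDGZ : Disegni2020.padicGrossZagier_nonsplitMult)
    (hNHT : Literature.NumberTheory.QuadraticFields.nakagawaHorie_taya_exists_imaginary_h3_eq_one)
    (hD : KellerYin2024.thmD_imcMult_exists_isBDPLFunction_isTorsion_charIdeal_eq_OPEN)
    (hStub : ∀ (W : WeierstrassCurve ℚ) [W.IsElliptic] [W.IsGloballyMinimal] (p : ℕ) [Fact p.Prime],
      X2.CellB W p →
      ¬ (p = 3 ∧ ¬ W.HasSplitMultiplicativeReductionAtPrime 3 ∧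
          ∃ (Φ₀ : AddSubgroup (geomTorsion W (3 : ℤ))) (m : ℕ) (_ : NeZero m) (φ : DirichletCharacter (ZMod 3) m)
            (d : ℕ) (_ : NeZero d) (ψ : DirichletCharacter (ZMod 3) d) (S₀ : Finset (HeightOneSpectrum (𝓞 ℚ))),
            IsRationalLine W 3 Φ₀ ∧ φ.IsPrimitive ∧ ψ.IsPrimitive ∧
            (∀ (σ : absoluteGaloisGroup ℚ), ∀ P ∈ Φ₀,
              σ • P = (φ ((modNCyclotomicCharacter ℚ m σ : (ZMod m)ˣ) : ZMod m)).val • P) ∧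
            (∀ (σ : absoluteGaloisGroup ℚ) (P : geomTorsion W (3 : ℤ)),
              σ • P - (ψ ((modNCyclotomicCharacter ℚ d σ : (ZMod d)ˣ) : ZMod d)).val • P ∈ Φ₀) ∧
            (∀ v ∈ S₀, ((3 : ℕ) : 𝓞 ℚ) ∉ v.asIdeal) ∧
            (∀ v : HeightOneSpectrum (𝓞 ℚ), v ∉ S₀ → ((3 : ℕ) : 𝓞 ℚ) ∉ v.asIdeal → W.HasGoodReductionAt v) ∧
            1 + ∑ v ∈ S₀, delta W 3 v =
              ∑ v ∈ S₀, ((if φ (Rat.HeightOneSpectrum.natGenerator v : ZMod m) =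
                    (Rat.HeightOneSpectrum.natGenerator v : ZMod 3)
                  then sFactor 3 (Rat.HeightOneSpectrum.natGenerator v) else 0) +
                (if ψ (Rat.HeightOneSpectrum.natGenerator v : ZMod d) =
                    (Rat.HeightOneSpectrum.natGenerator v : ZMod 3)
                  then sFactor 3 (Rat.HeightOneSpectrum.natGenerator v) else 0))) →
      ¬ (∃ (W₁ : WeierstrassCurve ℚ) (_ : W₁.IsElliptic) (_ : W₁.IsGloballyMinimal)
          (W'' : WeierstrassCurve ℚ) (_ : W''.IsElliptic) (_ : W''.IsGloballyMinimal)
          (Wc : WeierstrassCurve ℚ) (_ : Wc.IsElliptic) (_ : Wc.IsGloballyMinimal),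
          IsIsogenous W W₁ ∧
          Relation.ReflTransGen (fun A B : WeierstrassCurve ℚ ↦ TwoStepAt p A B ∨
            (TwoStepAt p B A ∧ ∃ (_ : B.IsElliptic) (_ : B.IsGloballyMinimal), X2.CellB B p)) W₁ W'' ∧
          IsIsogenous W'' Wc ∧
          ∃ q : ℚ, shaAn Wc = (q : ℂ) ∧ padicValRat p q = 0) →
      ¬ (∃ (W₁ : WeierstrassCurve ℚ) (_ : W₁.IsElliptic) (_ : W₁.IsGloballyMinimal)
          (W₀ : WeierstrassCurve ℚ) (_ : W₀.IsElliptic) (_ : W₀.IsGloballyMinimal),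
          IsIsogenous W W₁ ∧
          Relation.ReflTransGen (fun A B : WeierstrassCurve ℚ ↦ TwoStepAt p A B ∨
            (TwoStepAt p B A ∧ ∃ (_ : B.IsElliptic) (_ : B.IsGloballyMinimal), X2.CellB B p)) W₁ W₀ ∧
          ¬ W₀.HasSplitMultiplicativeReductionAtPrime p ∧
          ∃ (K : Type) (_ : Field K) (_ : NumberField K), IsImaginaryQuadratic K ∧
            SatisfiesHeegnerHypothesis (W₀.conductorNorm ℤ) K ∧ SatisfiesHeegnerHypothesis p K ∧
            Odd (NumberField.discr K) ∧ NumberField.discr K < -4 ∧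
            ∀ (Wd : WeierstrassCurve ℚ) [Wd.IsElliptic] [Wd.IsGloballyMinimal],
              (∃ C : VariableChange ℚ, C • Wd = W₀.quadraticTwist (NumberField.discr K : ℚ)) →
              ∀ {M : ℕ} [NeZero M] (f : CuspForm (Gamma0 M) 2), IsNewformOf Wd f →
              ∀ (ϖ : ℚ), (ϖ : ℝ) * Wd.realPeriodRat = plusPeriod f →
              ∀ L : PowerSeries ℚ_[p], IsMultPAdicLFunctionOf f p (-1) L → L.order = ((1 : ℕ) : ℕ∞)) →
      ∃ (K : Type) (_ : Field K) (_ : NumberField K), IsImaginaryQuadratic K ∧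
        SatisfiesHeegnerHypothesis (W.conductorNorm ℤ) K ∧ SatisfiesHeegnerHypothesis p K ∧
        Odd (NumberField.discr K) ∧ NumberField.discr K < -4 ∧
        (W.quadraticTwist (NumberField.discr K : ℚ)).analyticRank = 1 ∧
        ∀ (Wd : WeierstrassCurve ℚ) [Wd.IsElliptic] [Wd.IsGloballyMinimal],
          (∃ C : VariableChange ℚ, C • Wd = W.quadraticTwist (NumberField.discr K : ℚ)) →
          MissingUpperBoundAt Wd p) :
    Summit.BirchSwinnertonDyer.BirchSwinnertonDyer.Theses.EisensteinPrimes.MazurMCOnCellB := by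
  have hPT : ∀ (K : Type) [Field K] [NumberField K],
      Literature.NumberTheory.GaloisCohomology.poitouTate_selmerStructure_duality K :=
    fun K _ _ ↦ SchneiderFreeAdditiveX3.PoitouTateReduction.poitouTate_selmerStructure_duality_holds K
  have hPT2 : ∀ (K : Type) [Field K] [NumberField K],
      Literature.NumberTheory.GaloisCohomology.poitouTate_sha_tateDual K :=
    fun K _ _ ↦ SchneiderFreeAdditiveX3.PoitouTateReduction.poitouTate_sha_tateDual_holds K
  unfold EisensteinPrimes.MazurMCOnCellB
  intro W _ _ p _ hc
  by_cases h0 : ∃ (W' : WeierstrassCurve ℚ) (_ : W'.IsElliptic) (_ : W'.IsGloballyMinimal),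
      IsIsogenous W W' ∧ ∃ q : ℚ, shaAn W' = (q : ℂ) ∧ padicValRat p q = 0
  · exact EisensteinPrimesMazurMCOnCellBOfNamedFactsV9.mazurMainConjectureAt_of_namedFacts_of_classShaUnit
      hP hW21 W p hc h0
  by_cases hR : ∃ (W₁ : WeierstrassCurve ℚ) (_ : W₁.IsElliptic) (_ : W₁.IsGloballyMinimal)
          (W'' : WeierstrassCurve ℚ) (_ : W''.IsElliptic) (_ : W''.IsGloballyMinimal)
          (Wc : WeierstrassCurve ℚ) (_ : Wc.IsElliptic) (_ : Wc.IsGloballyMinimal),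
          IsIsogenous W W₁ ∧
          Relation.ReflTransGen (fun A B : WeierstrassCurve ℚ ↦ TwoStepAt p A B ∨
            (TwoStepAt p B A ∧ ∃ (_ : B.IsElliptic) (_ : B.IsGloballyMinimal), X2.CellB B p)) W₁ W'' ∧
          IsIsogenous W'' Wc ∧
          ∃ q : ℚ, shaAn Wc = (q : ℂ) ∧ padicValRat p q = 0
  · obtain ⟨W₁, _, _, W'', _, _, Wc, _, _, hiso₁, hz, hisoc, hunit⟩ := hR
    exact EisensteinPrimesMazurMCOnCellBTwistbackDefectSwapZigzag.mazurMainConjectureAt_of_cellB_of_connectedClassShaUnit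
      hP hW21 hMaz hH hF hD W p hc ⟨W₁, W'', Wc, inferInstance, inferInstance, inferInstance, inferInstance, inferInstance,
        inferInstance, hiso₁, hz, hisoc, hunit⟩
  by_cases hA : ∃ (W₁ : WeierstrassCurve ℚ) (_ : W₁.IsElliptic) (_ : W₁.IsGloballyMinimal)
      (W₀ : WeierstrassCurve ℚ) (_ : W₀.IsElliptic) (_ : W₀.IsGloballyMinimal),
      IsIsogenous W W₁ ∧
      Relation.ReflTransGen (fun A B : WeierstrassCurve ℚ ↦ TwoStepAt p A B ∨
        (TwoStepAt p B A ∧ ∃ (_ : B.IsElliptic) (_ : B.IsGloballyMinimal), X2.CellB B p)) W₁ W₀ ∧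
      ¬ W₀.HasSplitMultiplicativeReductionAtPrime p ∧
      ∃ (K : Type) (_ : Field K) (_ : NumberField K), IsImaginaryQuadratic K ∧
        SatisfiesHeegnerHypothesis (W₀.conductorNorm ℤ) K ∧ SatisfiesHeegnerHypothesis p K ∧
        Odd (NumberField.discr K) ∧ NumberField.discr K < -4 ∧
        ∀ (Wd : WeierstrassCurve ℚ) [Wd.IsElliptic] [Wd.IsGloballyMinimal],
          (∃ C : VariableChange ℚ, C • Wd = W₀.quadraticTwist (NumberField.discr K : ℚ)) →
          ∀ {M : ℕ} [NeZero M] (f : CuspForm (Gamma0 M) 2), IsNewformOf Wd f →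
          ∀ (ϖ : ℚ), (ϖ : ℝ) * Wd.realPeriodRat = plusPeriod f →
          ∀ L : PowerSeries ℚ_[p], IsMultPAdicLFunctionOf f p (-1) L → L.order = ((1 : ℕ) : ℕ∞)
  · exact EisensteinPrimesMazurMCOnCellBTwistbackOrderOneAnchorZigzag.mazurMainConjectureAt_of_cellB_of_connectedOrderOneAnchor
      hP hPT hPT2 hH hF hMaz hDis hDGZ hD W p hc hA
  -- the partner field: sub-row theorem or the stub
  have hK : ∃ (K : Type) (_ : Field K) (_ : NumberField K), IsImaginaryQuadratic K ∧
        SatisfiesHeegnerHypothesis (W.conductorNorm ℤ) K ∧ SatisfiesHeegnerHypothesis p K ∧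
        Odd (NumberField.discr K) ∧ NumberField.discr K < -4 ∧
        (W.quadraticTwist (NumberField.discr K : ℚ)).analyticRank = 1 ∧
        ∀ (Wd : WeierstrassCurve ℚ) [Wd.IsElliptic] [Wd.IsGloballyMinimal],
          (∃ C : VariableChange ℚ, C • Wd = W.quadraticTwist (NumberField.discr K : ℚ)) →
          MissingUpperBoundAt Wd p := by
    by_cases hsub : p = 3 ∧ ¬ W.HasSplitMultiplicativeReductionAtPrime 3 ∧
          ∃ (Φ₀ : AddSubgroup (geomTorsion W (3 : ℤ))) (m : ℕ) (_ : NeZero m) (φ : DirichletCharacter (ZMod 3) m)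
            (d : ℕ) (_ : NeZero d) (ψ : DirichletCharacter (ZMod 3) d) (S₀ : Finset (HeightOneSpectrum (𝓞 ℚ))),
            IsRationalLine W 3 Φ₀ ∧ φ.IsPrimitive ∧ ψ.IsPrimitive ∧
            (∀ (σ : absoluteGaloisGroup ℚ), ∀ P ∈ Φ₀,
              σ • P = (φ ((modNCyclotomicCharacter ℚ m σ : (ZMod m)ˣ) : ZMod m)).val • P) ∧
            (∀ (σ : absoluteGaloisGroup ℚ) (P : geomTorsion W (3 : ℤ)),
              σ • P - (ψ ((modNCyclotomicCharacter ℚ d σ : (ZMod d)ˣ) : ZMod d)).val • P ∈ Φ₀) ∧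
            (∀ v ∈ S₀, ((3 : ℕ) : 𝓞 ℚ) ∉ v.asIdeal) ∧
            (∀ v : HeightOneSpectrum (𝓞 ℚ), v ∉ S₀ → ((3 : ℕ) : 𝓞 ℚ) ∉ v.asIdeal → W.HasGoodReductionAt v) ∧
            1 + ∑ v ∈ S₀, delta W 3 v =
              ∑ v ∈ S₀, ((if φ (Rat.HeightOneSpectrum.natGenerator v : ZMod m) =
                    (Rat.HeightOneSpectrum.natGenerator v : ZMod 3)
                  then sFactor 3 (Rat.HeightOneSpectrum.natGenerator v) else 0) +
                (if ψ (Rat.HeightOneSpectrum.natGenerator v : ZMod d) =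
                    (Rat.HeightOneSpectrum.natGenerator v : ZMod 3)
                  then sFactor 3 (Rat.HeightOneSpectrum.natGenerator v) else 0))
    · obtain ⟨hp3, hns, hbal⟩ := hsub
      subst hp3
      exact EisensteinPrimesMazurMCOnCellBTwistbackSubrowPartnerAnyLinePAdicGZ.upperPartner_at_three_of_balanceOne_of_padicGZ
        hP hDis h311 hDGZ hNHT W hc hns hbal
    · exact hStub W p hc hsub hR hA
  obtain ⟨K, _, _, hK, hHN, hHp, hodd, hlt, hr1, hU⟩ := hK
  have hd0 : (NumberField.discr K : ℚ) ≠ 0 := by exact_mod_cast NumberField.discr_ne_zero K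
  obtain ⟨Wd, _, _, C, hC⟩ := exists_isGloballyMinimal_smul_eq_quadraticTwist W hd0
  exact EisensteinPrimesMazurMCOnCellBTwistbackOnePartnerAt.mazurMainConjectureAt_of_cellB_of_upper_partnerAt
    hP hPT hPT2 hH hF hMaz hD W p hc K hK hHN hHp hodd hlt hr1 Wd ⟨C, hC⟩ (hU Wd ⟨C, hC⟩)

end Summit.BirchSwinnertonDyer.BirchSwinnertonDyer.Theorems.EisensteinPrimesMazurMCOnCellBOfNamedFactsV11

end
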